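import Mathlib
import Summits.CriticalPhenomena.CardyFormulaZ2.Theorems.CardyMagicRigidityMagicFormulaTCloseComparisonMatching
import HarnessLib

/-!
# Deterministic comparison of threshold-averaged big-loop weights of two `d_CN`-close configurations
(crux `MagicFormulaT`, line `Sketch` v7, stub `stub_closeComparison`) — part 2/2

Crux `Summit.CriticalPhenomena.CardyFormulaZ2.Theses.CardyMagicRigidity.MagicFormulaT`
(stmt-CriticalPhenomena-4836), line `Sketch`, skeleton v7 (EXISTENCE ∧ IDENTIFICATION), stub B
(`stub_closeComparison`): the deterministic heart of the Cauchy argument for the existence of the scaling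
limit of the site-`𝕋` twisted nesting transform.

**Setting.**  `f` is an admissible density (`|f| ≤ C`, `f = 0` off `B̄(0,R)`, measurable, `∫ f = 0`); `c, c'` are
two typed loop configurations with `d_CN(c, c') ≤ ε` (`LoopConfig.IsClose ε c c'`: every loop of either
configuration inside the window `B(0, 1/ε)` has a loop of the other at unoriented loop distance `d ≤ ε`).  Call a
loop RELEVANT if it meets `B̄(0, R+1)` and has trace-diameter `≥ η/5`.  Hypotheses ("the good event"): the
relevant loops of `c` and of `c'` are finitely many (`≤ N₀`), lie in the window, are pairwise `2ε`-separated in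
`d` (RIBBON-FREE), and the `ε`-sausage of every relevant loop of `c` has area `≤ τ` inside `B̄(0, R)`; and
`8 m ε ≤ η`.

**Theorem** (`stub_closeComparison`).  The averages over the `m` thresholds `η_j = η/2 + (j+1)η/(2m) ∈ (η/2, η]`
of the truncated weights `A^{η_j}_f = ∏_{diam u ≥ η_j} 2cos(∫_{int u} f + π/3)` of `c` and of `c'` differ by at
most `2^{N₀} N₀ (4Cτ + 8πCη²/m)`.

**Proof.**  (1) MATCHING.  Let `P` be the set of pairs `(x, y) ∈ c.loops × c'.loops` with `d(x, y) ≤ ε` and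
(`x` meets `B̄(0,R)` with `diam x ≥ η/2`, or the same for `y`).  Both members of such a pair are relevant
(diameters move by `≤ 2ε ≤ η/4` and traces by `≤ ε ≤ 1` under `d ≤ ε`), so `P` is finite, and by
ribbon-freeness both projections of `P` are injective (two partners of one loop are `2ε`-close): `P` is a partial
BIJECTION and `#P ≤ N₀`.  By `IsClose` and the window hypothesis every loop of `c` meeting `B̄(0,R)` with
`diam ≥ η/2` is a first coordinate of `P` (and symmetrically), and only such loops contribute a factor `≠ 1` at a
threshold `t ≥ η/2` (`range_inter_closedBall_nonempty_of_nestingFactor_ne_one`), so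
`A^t_f(c) = ∏_{(x,y) ∈ P} a_t(x)`, `A^t_f(c') = ∏_{(x,y) ∈ P} a_t(y)` with `a_t(u) = [t ≤ diam u] cos_μ(θ_u) + [t > diam u]`.
(2) PER PAIR.  `|a_t(x) − a_t(y)| ≤ 2Cτ` when both are big (`cos_μ` is `2`-Lipschitz, phases of `ε`-close loops
differ by `≤ C ·` sausage area), `= 0` when both are small, and `≤ 2|θ| ≤ 2πC (5η/4)² ≤ 4πCη²` in the mixed
case (then the big one has `diam ≤ t + 2ε ≤ 5η/4`); the mixed case occurs for AT MOST ONE threshold (the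
thresholds are `η/(2m) ≥ 4ε` apart while `|diam x − diam y| ≤ 2ε`).  Hence `Σ_j |a_j(x) − a_j(y)| ≤ 2Cτ m + 4πCη²`.
(3) PRODUCTS.  `|∏ a − ∏ b| ≤ 2^{#P} Σ |a − b|` (`Finset.abs_prod_sub_prod_le`), sum over `j`, divide by `m`.

The lemmas of steps (1)–(3) are in part 1/2 (`…CloseComparisonMatching.lean`, prefix `cc_`); this file assembles them.
Everything is proved from tree material; no definition, no cited fact.
-/

noncomputable section

namespace Summit.CriticalPhenomena.CardyFormulaZ2.Cruxes.MagicFormulaT.LineSketch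

open MeasureTheory Filter Set Metric
open scoped Real Topology BigOperators ENNReal
open Literature.Probability.RandomPlanarGeometry Literature.Probability.Percolation
  Literature.Probability.LatticeModels

/-! ## The stub -/

/-- **Stub B of line `Sketch` v7 (`stub_closeComparison`): deterministic comparison of the threshold-averaged
big-loop weights of two `d_CN`-close configurations** whose relevant loops (diameter `≥ η/5`, meeting
`B̄(0,R+1)`) are finitely many (`≤ N₀`), inside the window `B(0,1/ε)`, pairwise `2ε`-SEPARATED (ribbon-free), the
first configuration having `ε`-sausages of area `≤ τ` in `B̄(0,R)`: the averages over the `m` thresholds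
`η_j = η/2 + (j+1)η/(2m)` differ by `≤ 2^{N₀} N₀ (4Cτ + 8πCη²/m)`.  See the module docstring for the proof. -/
theorem stub_closeComparison :
    ∀ (f : ℂ → ℝ) (R C : ℝ), Measurable f → (∀ z, |f z| ≤ C) → (∀ z, R < ‖z‖ → f z = 0) → ∫ z, f z = 0 →
    ∀ (c c' : LoopConfig ℂ) (ε η τ : ℝ) (m N₀ : ℕ), 0 < ε → ε ≤ 1 → 0 < η → 8 * m * ε ≤ η → 0 ≤ τ →
    LoopConfig.IsClose ε c c' →
    ({u ∈ c.loops | (u.range ∩ Metric.closedBall (0 : ℂ) (R + 1)).Nonempty ∧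
        η / 5 ≤ Metric.diam u.range}.Finite ∧
      {u ∈ c.loops | (u.range ∩ Metric.closedBall (0 : ℂ) (R + 1)).Nonempty ∧
        η / 5 ≤ Metric.diam u.range}.ncard ≤ N₀) →
    ({u ∈ c'.loops | (u.range ∩ Metric.closedBall (0 : ℂ) (R + 1)).Nonempty ∧
        η / 5 ≤ Metric.diam u.range}.Finite ∧
      {u ∈ c'.loops | (u.range ∩ Metric.closedBall (0 : ℂ) (R + 1)).Nonempty ∧
        η / 5 ≤ Metric.diam u.range}.ncard ≤ N₀) →
    (∀ u ∈ c.loops, (u.range ∩ Metric.closedBall (0 : ℂ) (R + 1)).Nonempty → η / 5 ≤ Metric.diam u.range →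
      u.range ⊆ Metric.ball (0 : ℂ) (1 / ε)) →
    (∀ u ∈ c'.loops, (u.range ∩ Metric.closedBall (0 : ℂ) (R + 1)).Nonempty → η / 5 ≤ Metric.diam u.range →
      u.range ⊆ Metric.ball (0 : ℂ) (1 / ε)) →
    (∀ u ∈ c.loops, ∀ v ∈ c.loops, (u.range ∩ Metric.closedBall (0 : ℂ) (R + 1)).Nonempty →
      (v.range ∩ Metric.closedBall (0 : ℂ) (R + 1)).Nonempty → η / 5 ≤ Metric.diam u.range →
      η / 5 ≤ Metric.diam v.range → u ≠ v → 2 * ε < u.udist v) →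
    (∀ u ∈ c'.loops, ∀ v ∈ c'.loops, (u.range ∩ Metric.closedBall (0 : ℂ) (R + 1)).Nonempty →
      (v.range ∩ Metric.closedBall (0 : ℂ) (R + 1)).Nonempty → η / 5 ≤ Metric.diam u.range →
      η / 5 ≤ Metric.diam v.range → u ≠ v → 2 * ε < u.udist v) →
    (∀ u ∈ c.loops, (u.range ∩ Metric.closedBall (0 : ℂ) (R + 1)).Nonempty → η / 5 ≤ Metric.diam u.range →
      volume.real ({z : ℂ | Metric.infDist z u.range ≤ ε} ∩ Metric.closedBall (0 : ℂ) R) ≤ τ) →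
    |(∑ j ∈ Finset.range m, c.truncNestingWeight f (η / 2 + ((j : ℝ) + 1) * η / (2 * m))) / m -
        (∑ j ∈ Finset.range m, c'.truncNestingWeight f (η / 2 + ((j : ℝ) + 1) * η / (2 * m))) / m| ≤
      2 ^ N₀ * N₀ * (4 * C * τ + 8 * π * C * η ^ 2 / m) := by
  intro f R C hf hC hR h0 c c' ε η τ m N₀ hε hε1 hη hmε hτ hclose hA hA' hwin hwin' hsep hsep' hsaus
  classical
  have hC0 : 0 ≤ C := nonneg_of_abs_le hC
  rcases Nat.eq_zero_or_pos m with rfl | hm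
  · simp only [Finset.range_zero, Finset.sum_empty, Nat.cast_zero, div_zero, sub_self, abs_zero, add_zero]
    positivity
  have hm' : (0 : ℝ) < m := by exact_mod_cast hm
  have hεη : 8 * ε ≤ η := by
    have : (1 : ℝ) ≤ m := by exact_mod_cast hm
    nlinarith
  -- the matched pairs `P`
  have hPfin : {p : UnbasedLoop ℂ × UnbasedLoop ℂ | p.1 ∈ c.loops ∧ p.2 ∈ c'.loops ∧ p.1.udist p.2 ≤ ε ∧
      ((p.1.range ∩ closedBall (0 : ℂ) R).Nonempty ∧ η / 2 ≤ diam p.1.range ∨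
        (p.2.range ∩ closedBall (0 : ℂ) R).Nonempty ∧ η / 2 ≤ diam p.2.range)}.Finite := by
    refine (hA.1.prod hA'.1).subset ?_
    rintro ⟨x, y⟩ ⟨hx, hy, hxy, hrel⟩
    have h := cc_pair_rel hε1 hεη hη.le hx hy hxy hrel
    exact Set.mk_mem_prod h.1 h.2
  obtain ⟨P, hP⟩ : ∃ P : Finset (UnbasedLoop ℂ × UnbasedLoop ℂ), ∀ p, p ∈ P ↔
      p.1 ∈ c.loops ∧ p.2 ∈ c'.loops ∧ p.1.udist p.2 ≤ ε ∧
        ((p.1.range ∩ closedBall (0 : ℂ) R).Nonempty ∧ η / 2 ≤ diam p.1.range ∨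
          (p.2.range ∩ closedBall (0 : ℂ) R).Nonempty ∧ η / 2 ≤ diam p.2.range) :=
    ⟨hPfin.toFinset, fun p ↦ by simp only [Set.Finite.mem_toFinset, mem_setOf_eq]⟩
  have hrel : ∀ p ∈ P,
      (p.1 ∈ c.loops ∧ (p.1.range ∩ closedBall (0 : ℂ) (R + 1)).Nonempty ∧ η / 5 ≤ diam p.1.range) ∧
        (p.2 ∈ c'.loops ∧ (p.2.range ∩ closedBall (0 : ℂ) (R + 1)).Nonempty ∧ η / 5 ≤ diam p.2.range) := by
    intro p hp
    obtain ⟨hx, hy, hxy, hr⟩ := (hP p).1 hp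
    exact cc_pair_rel hε1 hεη hη.le hx hy hxy hr
  -- ribbon-freeness: both projections of `P` are injective
  have hinj1 : Set.InjOn Prod.fst (↑P : Set (UnbasedLoop ℂ × UnbasedLoop ℂ)) := by
    intro p hp q hq h
    rw [Finset.mem_coe] at hp hq
    refine Prod.ext h (cc_eq_of_udist_le hsep' (hrel p hp).2 (hrel q hq).2 ((hP p).1 hp).2.2.1 ?_)
    rw [h]
    exact ((hP q).1 hq).2.2.1
  have hinj2 : Set.InjOn Prod.snd (↑P : Set (UnbasedLoop ℂ × UnbasedLoop ℂ)) := by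
    intro p hp q hq h
    rw [Finset.mem_coe] at hp hq
    refine Prod.ext (cc_eq_of_udist_le hsep (hrel p hp).1 (hrel q hq).1 (x := p.2) ?_ ?_) h
    · rw [UnbasedLoop.udist_comm]
      exact ((hP p).1 hp).2.2.1
    · rw [h, UnbasedLoop.udist_comm]
      exact ((hP q).1 hq).2.2.1
  -- at most `N₀` pairs
  have hcard : P.card ≤ N₀ := by
    have hsub : P.image Prod.fst ⊆ hA.1.toFinset := by
      intro x hx
      rw [Finset.mem_image] at hx
      obtain ⟨p, hp, rfl⟩ := hx
      rw [Set.Finite.mem_toFinset]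
      exact (hrel p hp).1
    calc P.card = (P.image Prod.fst).card := (Finset.card_image_of_injOn hinj1).symm
      _ ≤ hA.1.toFinset.card := Finset.card_le_card hsub
      _ = Set.ncard _ := (Set.ncard_eq_toFinset_card _ hA.1).symm
      _ ≤ N₀ := hA.2
  -- every contributing loop is matched
  have hcov1 : ∀ x ∈ c.loops, (x.range ∩ closedBall (0 : ℂ) R).Nonempty → η / 2 ≤ diam x.range →
      ∃ p ∈ P, Prod.fst p = x := by
    intro x hx hxR hxd
    obtain ⟨y, hy, hxy⟩ := cc_exists_partner hclose hwin hη.le hx hxR hxd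
    exact ⟨(x, y), (hP _).2 ⟨hx, hy, hxy, Or.inl ⟨hxR, hxd⟩⟩, rfl⟩
  have hcov2 : ∀ y ∈ c'.loops, (y.range ∩ closedBall (0 : ℂ) R).Nonempty → η / 2 ≤ diam y.range →
      ∃ p ∈ P, Prod.snd p = y := by
    intro y hy hyR hyd
    obtain ⟨x, hx, hyx⟩ := cc_exists_partner hclose.symm hwin' hη.le hy hyR hyd
    exact ⟨(x, y), (hP _).2 ⟨hx, hy, by rwa [UnbasedLoop.udist_comm], Or.inr ⟨hyR, hyd⟩⟩, rfl⟩
  -- thresholds are `≥ η/2`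
  have hT : ∀ j : ℕ, η / 2 ≤ η / 2 + ((j : ℝ) + 1) * η / (2 * m) := fun j ↦
    le_add_of_nonneg_right (by positivity)
  -- the abstract averaging step
  have key := cc_abs_avg_sub_avg_le P hm hcard
    (fun j ↦ c.truncNestingWeight f (η / 2 + ((j : ℝ) + 1) * η / (2 * m)))
    (fun j ↦ c'.truncNestingWeight f (η / 2 + ((j : ℝ) + 1) * η / (2 * m)))
    (fun j p ↦ if η / 2 + ((j : ℝ) + 1) * η / (2 * m) ≤ diam p.1.range then p.1.nestingFactor f else 1)
    (fun j p ↦ if η / 2 + ((j : ℝ) + 1) * η / (2 * m) ≤ diam p.2.range then p.2.nestingFactor f else 1)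
    (K := 2 * C * τ) (D := 4 * π * C * η ^ 2) (by positivity) (by positivity)
    (fun j _ ↦ cc_truncNestingWeight_eq_prod hR h0 c P Prod.fst hinj1 (fun p hp ↦ ((hP p).1 hp).1)
      (hT j) hcov1)
    (fun j _ ↦ cc_truncNestingWeight_eq_prod hR h0 c' P Prod.snd hinj2 (fun p hp ↦ ((hP p).1 hp).2.1)
      (hT j) hcov2)
    (fun j _ p _ ↦ by
      split_ifs
      exacts [UnbasedLoop.abs_nestingFactor_le f _, by norm_num])
    (fun j _ p _ ↦ by
      split_ifs
      exacts [UnbasedLoop.abs_nestingFactor_le f _, by norm_num])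
    (fun p hp ↦ cc_sum_abs_sub_le hf hC hR hε hm hmε ((hP p).1 hp).2.2.1
      (hsaus p.1 (hrel p hp).1.1 (hrel p hp).1.2.1 (hrel p hp).1.2.2))
  refine key.trans ?_
  have h1 : 2 * C * τ ≤ 4 * C * τ := by nlinarith [mul_nonneg hC0 hτ]
  have h2 : 4 * π * C * η ^ 2 / m ≤ 8 * π * C * η ^ 2 / m := by
    apply div_le_div_of_nonneg_right _ hm'.le
    nlinarith [mul_nonneg (mul_nonneg Real.pi_pos.le hC0) (sq_nonneg η)]
  have h3 : (0 : ℝ) ≤ 2 ^ N₀ * N₀ := by positivity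
  exact mul_le_mul_of_nonneg_left (add_le_add h1 h2) h3

end Summit.CriticalPhenomena.CardyFormulaZ2.Cruxes.MagicFormulaT.LineSketch

end
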